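import Mathlib
import Literature.Geometry.Lorentzian.Basic
import Literature.Analysis.Calculus.PolarCoordinatesE3
import Summits.FinalStateConjecture.FinalStateConjecture.Theorems.StarvedNecksNecksCertifyStubHuygensNeckSphereMeans
import Summits.FinalStateConjecture.FinalStateConjecture.Theorems.EIHFluxBalanceModulatedKerrHandoffStubRetardedConeEstimateHelpers

/-!
# Line `cone-rates-are-iled`, stub S2c: the retarded-cone estimate for the two-centre profile

Stub `stub_retardedConeEstimate` of crux `ModulatedKerrHandoff` (thesis `EIHFluxBalance`): if
`f(t, ·)` is supported in the lab cone `‖x‖ ≤ κt` (`t ≥ 1`) and bounded by the Lie-dragged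
two-centre profile `A t⁻² [(M + ‖x − ½vt e₁‖)⁻² + (M + ‖x + ½vt e₁‖)⁻²]`, then for observers in the
cone the retarded integral `σ(S²)⁻¹ ∫₀^{t−1} s ∫_{S²} |f(t−s, x+sw)| dσ ds` is
`≤ C(M,v,κ) A log(1+t)/t²`.

Proof: (1) on the support of the integrand the retarded time `t − s` is at least `λt`,
`λ = (1−κ)/(1+κ)`, so `|f(t−s, x+sw)| ≤ A(λt)⁻² (G₋ + G₊)(sw)` with
`G∓(y) = (M + ‖x + y ∓ ½v(t−‖y‖) e₁‖)⁻²`; (2) the real integral is bounded by the Lebesgue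
integral of the bound, which in polar coordinates about the observer is
`A(λt)⁻² Σ± ∫_{B̄(0,t−1)} G±(y)/‖y‖ dy`; (3) the dragged centres `y ↦ x + y ∓ ½v(t−‖y‖)e₁`
expand distances by at least `1/2`, so the dyadic-shell volume estimate of the helper file
(`…StubRetardedConeEstimateHelpers`) bounds each integral by `64 (K+1) (σ(S²) + vol B̄(0,1))`
with `2^K ≤ 1 + 3t/M`, i.e. `K + 1 = O_M(log(1+t))`.  Mathlib plus the tree; no definitions.
-/

noncomputable section

open scoped Manifold ContDiff Topology ENNReal BigOperators
open Filter Set MeasureTheory Metric Function Literature.Geometry.Lorentzian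

-- the doubled `FinalStateConjecture.FinalStateConjecture` path component trips dupNamespace
set_option linter.dupNamespace false
set_option linter.style.longLine false

namespace Summit.FinalStateConjecture.FinalStateConjecture.Theorems.EIHFluxBalance.ConeRatesAreILED

open Summit.FinalStateConjecture.FinalStateConjecture.Theorems.NecksCertifyTwoCap.Huygens

/-- Counting dyadic shells: if `2^K ≤ (M + 3t)/M` with `t ≥ 1`, then
`K + 1 ≤ C₃(M) log(1 + t)` with `C₃(M) = (log(1 + 3/M)/log 2 + 2)/log 2`. -/
theorem natCast_add_one_le_mul_log {M t : ℝ} (hM : 0 < M) (ht : 1 ≤ t) {K : ℕ}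
    (hK : (2 : ℝ) ^ K ≤ (M + 3 * t) / M) :
    (K : ℝ) + 1 ≤ (Real.log (1 + 3 / M) / Real.log 2 + 2) / Real.log 2 * Real.log (1 + t) := by
  have hl : 0 < Real.log 2 := Real.log_pos one_lt_two
  have hP : 0 ≤ Real.log (1 + 3 / M) :=
    Real.log_nonneg (by have := div_pos three_pos hM; linarith)
  have h1 : (K : ℝ) * Real.log 2 ≤ Real.log ((M + 3 * t) / M) := by
    rw [← Real.log_pow]
    exact Real.log_le_log (by positivity) hK
  have h2 : Real.log ((M + 3 * t) / M) ≤ Real.log (1 + 3 / M) + Real.log (1 + t) := by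
    rw [← Real.log_mul (by positivity) (by positivity)]
    refine Real.log_le_log (by positivity) ?_
    rw [div_le_iff₀ hM]
    have : (1 + 3 / M) * (1 + t) * M = (M + 3) * (1 + t) := by field_simp
    rw [this]
    nlinarith
  have h3 : Real.log 2 ≤ Real.log (1 + t) := Real.log_le_log two_pos (by linarith)
  have hLl : 1 ≤ Real.log (1 + t) / Real.log 2 := by rwa [le_div_iff₀ hl, one_mul]
  have hK' : (K : ℝ) ≤ (Real.log (1 + 3 / M) + Real.log (1 + t)) / Real.log 2 := by
    rw [le_div_iff₀ hl]
    linarith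
  set P := Real.log (1 + 3 / M) with hPdef
  set L := Real.log (1 + t) with hLdef
  set l := Real.log 2 with hldef
  have hPl : 0 ≤ P / l := div_nonneg hP hl.le
  have hmul : P / l * 1 ≤ P / l * (L / l) := mul_le_mul_of_nonneg_left hLl hPl
  calc (K : ℝ) + 1 ≤ (P + L) / l + 1 := by linarith
    _ = P / l * 1 + L / l + 1 := by ring
    _ ≤ P / l * (L / l) + L / l + L / l := by linarith
    _ = (P / l + 2) / l * L := by ring

/-- **Stub S2c `stub_retardedConeEstimate`** (registered on stmt-FinalStateConjecture-17402, line `cone-rates-are-iled`): the retarded potential of the Lie-dragged two-centre profile is `O(A log(1+t)/t²)` in the lab cone. [folklore] -/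
theorem stub_retardedConeEstimate :
    ∀ (A M v κ : ℝ), 0 ≤ A → 0 < M → 0 < v → v < κ → κ < 1 → ∃ C : ℝ, ∀ (f : ℝ → E3 → ℝ), Continuous (fun p : ℝ × E3 ↦ f p.1 p.2) → (∀ t x, 1 ≤ t → κ * t < ‖x‖ → f t x = 0) → (∀ t x, 1 ≤ t → |f t x| ≤ A * t⁻¹ ^ 2 * ((M + ‖x - (v * t / 2) • EuclideanSpace.single (0 : Fin 3) (1 : ℝ)‖)⁻¹ ^ 2 + (M + ‖x + (v * t / 2) • EuclideanSpace.single (0 : Fin 3) (1 : ℝ)‖)⁻¹ ^ 2)) → ∀ (t : ℝ) (x : E3), 1 ≤ t → ‖x‖ ≤ κ * t → ((((volume : Measure E3).toSphere univ).toReal)⁻¹ * ∫ s in (0 : ℝ)..(t - 1), s * ∫ (w : Metric.sphere (0 : E3) 1), |f (t - s) (x + s • (w : E3))| ∂((volume : Measure E3).toSphere)) ≤ C * A * Real.log (1 + t) / t ^ 2 := by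
  intro A M v κ hA hM hv hvκ hκ
  set μS : Measure (sphere (0 : E3) 1) := (volume : Measure E3).toSphere with hμS
  set c : ℝ := (μS univ).toReal with hcdef
  have hc : 0 < c := by
    have h := SphereMeans.measureReal_sphere_univ_pos
    rwa [measureReal_def] at h
  set Cb : ℝ := c + (volume (closedBall (0 : E3) 1)).toReal with hCb_def
  have hCb : 0 ≤ Cb := by positivity
  set lam : ℝ := (1 - κ) / (1 + κ) with hlam
  have hlam0 : 0 < lam := div_pos (by linarith) (by linarith)
  have hl2 : 0 < Real.log 2 := Real.log_pos one_lt_two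
  set C₃ : ℝ := (Real.log (1 + 3 / M) / Real.log 2 + 2) / Real.log 2 with hC₃
  have hC₃0 : 0 ≤ C₃ := by
    have : 0 ≤ Real.log (1 + 3 / M) :=
      Real.log_nonneg (by have := div_pos three_pos hM; linarith)
    positivity
  refine ⟨c⁻¹ * lam⁻¹ ^ 2 * (2 * (64 * Cb)) * C₃, ?_⟩
  intro f _ hsupp hbd t x ht hx
  set e₁ : E3 := EuclideanSpace.single (0 : Fin 3) (1 : ℝ) with he₁
  have he₁n : ‖e₁‖ = 1 := by simp [he₁]
  have ht0 : 0 < t := by linarith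
  have hxt : ‖x‖ ≤ t := hx.trans (mul_le_of_le_one_left ht0.le hκ.le)
  set T : ℝ := t - 1 with hT
  have hT0 : 0 ≤ T := by linarith
  have hTt : T ≤ t := by linarith
  -- the number of dyadic shells
  obtain ⟨K, hK1, hK2⟩ : ∃ K : ℕ, (2 : ℝ) ^ K ≤ (M + 3 * t) / M ∧ (M + 3 * t) / M < 2 ^ (K + 1) :=
    exists_nat_pow_near (by rw [le_div_iff₀ hM]; linarith) one_lt_two
  have hKM : M + 3 * t < 2 ^ (K + 1) * M := by rwa [div_lt_iff₀ hM] at hK2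
  have hKlog : (K : ℝ) + 1 ≤ C₃ * Real.log (1 + t) := natCast_add_one_le_mul_log hM ht hK1
  -- the two dragged profiles, as functions of `y = s • w`
  have ham : |(-(v / 2))| ≤ 1 / 2 := by rw [abs_neg, abs_of_pos (by linarith)]; linarith
  have hap : |v / 2| ≤ 1 / 2 := by rw [abs_of_pos (by linarith)]; linarith
  set Gm : E3 → ℝ≥0∞ := fun y ↦
    ENNReal.ofReal ((M + ‖x + y + (-(v / 2) * (t - ‖y‖)) • e₁‖)⁻¹ ^ 2) with hGm
  set Gp : E3 → ℝ≥0∞ := fun y ↦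
    ENNReal.ofReal ((M + ‖x + y + (v / 2 * (t - ‖y‖)) • e₁‖)⁻¹ ^ 2) with hGp
  have hGmm : Measurable Gm := by
    rw [hGm]
    refine ENNReal.measurable_ofReal.comp (Measurable.pow_const (Measurable.inv ?_) 2)
    exact measurable_const.add (Continuous.measurable (by fun_prop)).norm
  have hGpm : Measurable Gp := by
    rw [hGp]
    refine ENNReal.measurable_ofReal.comp (Measurable.pow_const (Measurable.inv ?_) 2)
    exact measurable_const.add (Continuous.measurable (by fun_prop)).norm
  -- from the interval integral to a Lebesgue integral over `Ioc 0 T`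
  have hI : ∫ s in (0 : ℝ)..T, s * ∫ w, |f (t - s) (x + s • (w : E3))| ∂μS ≤
      (∫⁻ s in Ioc (0 : ℝ) T, ‖s * ∫ w, |f (t - s) (x + s • (w : E3))| ∂μS‖ₑ).toReal := by
    rw [intervalIntegral.integral_of_le hT0]
    refine (le_abs_self _).trans ?_
    have h := norm_integral_le_lintegral_norm (μ := volume.restrict (Ioc (0 : ℝ) T))
      (fun s ↦ s * ∫ w, |f (t - s) (x + s • (w : E3))| ∂μS)
    rw [Real.norm_eq_abs] at h
    refine h.trans (le_of_eq ?_)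
    congr 1
    exact lintegral_congr fun s ↦ ofReal_norm _
  -- pointwise bound on the integrand (retarded times `t - s ≥ λ t`)
  have hpt : ∀ s ∈ Ioc (0 : ℝ) T, ‖s * ∫ w, |f (t - s) (x + s • (w : E3))| ∂μS‖ₑ ≤
      ENNReal.ofReal (A * (lam * t)⁻¹ ^ 2) *
        (ENNReal.ofReal s * ∫⁻ w, (Gm (s • (w : E3)) + Gp (s • (w : E3))) ∂μS) := by
    intro s hs
    have hs0 : 0 < s := hs.1
    have hts : 1 ≤ t - s := by linarith [hs.2]
    have hn : ∀ w : sphere (0 : E3) 1, ‖s • (w : E3)‖ = s := fun w ↦ by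
      rw [norm_smul, Real.norm_eq_abs, abs_of_pos hs0, norm_eq_of_mem_sphere w, mul_one]
    have hw : ∀ w : sphere (0 : E3) 1, ‖|f (t - s) (x + s • (w : E3))|‖ₑ ≤
        ENNReal.ofReal (A * (lam * t)⁻¹ ^ 2) * (Gm (s • (w : E3)) + Gp (s • (w : E3))) := by
      intro w
      rw [Real.enorm_abs, Real.enorm_eq_ofReal_abs]
      by_cases h0 : f (t - s) (x + s • (w : E3)) = 0
      · rw [h0, abs_zero, ENNReal.ofReal_zero]
        exact zero_le
      have hcone : ‖x + s • (w : E3)‖ ≤ κ * (t - s) :=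
        not_lt.1 fun hlt ↦ h0 (hsupp _ _ hts hlt)
      have hsw : s ≤ ‖x + s • (w : E3)‖ + ‖x‖ := by
        have := norm_sub_le (x + s • (w : E3)) x
        rwa [add_sub_cancel_left, hn w] at this
      have hlamt : lam * t ≤ t - s := by
        rw [hlam, div_mul_eq_mul_div, div_le_iff₀ (by linarith)]
        nlinarith
      have hinv : (t - s)⁻¹ ^ 2 ≤ (lam * t)⁻¹ ^ 2 :=
        pow_le_pow_left₀ (inv_nonneg.2 (by linarith)) (inv_anti₀ (mul_pos hlam0 ht0) hlamt) 2
      have hb := hbd (t - s) (x + s • (w : E3)) hts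
      have hvm : x + s • (w : E3) - (v * (t - s) / 2) • e₁ =
          x + s • (w : E3) + (-(v / 2) * (t - s)) • e₁ := by
        rw [show -(v / 2) * (t - s) = -(v * (t - s) / 2) by ring, neg_smul, sub_eq_add_neg]
      have hvp : x + s • (w : E3) + (v * (t - s) / 2) • e₁ =
          x + s • (w : E3) + (v / 2 * (t - s)) • e₁ := by
        rw [show v / 2 * (t - s) = v * (t - s) / 2 by ring]
      rw [hvm, hvp] at hb
      have hG : Gm (s • (w : E3)) + Gp (s • (w : E3)) =
          ENNReal.ofReal ((M + ‖x + s • (w : E3) + (-(v / 2) * (t - s)) • e₁‖)⁻¹ ^ 2) +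
          ENNReal.ofReal ((M + ‖x + s • (w : E3) + (v / 2 * (t - s)) • e₁‖)⁻¹ ^ 2) := by
        simp only [hGm, hGp, hn w]
      rw [hG, ← ENNReal.ofReal_add (by positivity) (by positivity),
        ← ENNReal.ofReal_mul (by positivity)]
      refine ENNReal.ofReal_le_ofReal (hb.trans ?_)
      exact mul_le_mul_of_nonneg_right (mul_le_mul_of_nonneg_left hinv hA) (by positivity)
    calc ‖s * ∫ w, |f (t - s) (x + s • (w : E3))| ∂μS‖ₑ
        = ENNReal.ofReal s * ‖∫ w, |f (t - s) (x + s • (w : E3))| ∂μS‖ₑ := by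
          rw [enorm_mul, Real.enorm_eq_ofReal hs0.le]
      _ ≤ ENNReal.ofReal s * ∫⁻ w, ‖|f (t - s) (x + s • (w : E3))|‖ₑ ∂μS := by
          gcongr
          exact enorm_integral_le_lintegral_enorm _
      _ ≤ ENNReal.ofReal s * ∫⁻ w, ENNReal.ofReal (A * (lam * t)⁻¹ ^ 2) *
            (Gm (s • (w : E3)) + Gp (s • (w : E3))) ∂μS := by
          gcongr with w
          exact hw w
      _ = _ := by
          rw [lintegral_const_mul' _ _ ENNReal.ofReal_ne_top]
          ring
  -- integrate in `s`, go to polar coordinates about `x`, and split the two centres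
  have hB : ∫⁻ s in Ioc (0 : ℝ) T, ENNReal.ofReal s *
      ∫⁻ w, (Gm (s • (w : E3)) + Gp (s • (w : E3))) ∂μS ≤
      ENNReal.ofReal ((K + 1) * (64 * Cb)) + ENNReal.ofReal ((K + 1) * (64 * Cb)) := by
    have hGBm : Measurable fun u ↦ (closedBall (0 : E3) T).indicator
        (fun u ↦ Gm u * (ENNReal.ofReal ‖u‖)⁻¹) u :=
      (hGmm.mul (ENNReal.measurable_ofReal.comp measurable_norm).inv).indicator
        measurableSet_closedBall
    have hsplit : ∀ u, (closedBall (0 : E3) T).indicator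
        (fun u ↦ (Gm u + Gp u) * (ENNReal.ofReal ‖u‖)⁻¹) u =
        (closedBall (0 : E3) T).indicator (fun u ↦ Gm u * (ENNReal.ofReal ‖u‖)⁻¹) u +
        (closedBall (0 : E3) T).indicator (fun u ↦ Gp u * (ENNReal.ofReal ‖u‖)⁻¹) u := by
      intro u
      by_cases hu : u ∈ closedBall (0 : E3) T
      · simp only [indicator_of_mem hu, add_mul]
      · simp only [indicator_of_notMem hu, add_zero]
    rw [lintegral_Ioc_mul_sphere_eq (G := fun y ↦ Gm y + Gp y) (hGmm.add hGpm) T,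
      lintegral_congr hsplit, lintegral_add_left hGBm]
    exact add_le_add
      (lintegral_closedBall_indicator_dragCentre_le x e₁ he₁n ham hM hT0 hTt hxt hKM)
      (lintegral_closedBall_indicator_dragCentre_le x e₁ he₁n hap hM hT0 hTt hxt hKM)
  -- assemble
  have hfin : ∫⁻ s in Ioc (0 : ℝ) T, ‖s * ∫ w, |f (t - s) (x + s • (w : E3))| ∂μS‖ₑ ≤
      ENNReal.ofReal (A * (lam * t)⁻¹ ^ 2 * (2 * ((K + 1) * (64 * Cb)))) := by
    calc ∫⁻ s in Ioc (0 : ℝ) T, ‖s * ∫ w, |f (t - s) (x + s • (w : E3))| ∂μS‖ₑ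
        ≤ ∫⁻ s in Ioc (0 : ℝ) T, ENNReal.ofReal (A * (lam * t)⁻¹ ^ 2) *
            (ENNReal.ofReal s * ∫⁻ w, (Gm (s • (w : E3)) + Gp (s • (w : E3))) ∂μS) :=
          setLIntegral_mono' measurableSet_Ioc hpt
      _ = ENNReal.ofReal (A * (lam * t)⁻¹ ^ 2) * ∫⁻ s in Ioc (0 : ℝ) T,
            ENNReal.ofReal s * ∫⁻ w, (Gm (s • (w : E3)) + Gp (s • (w : E3))) ∂μS :=
          lintegral_const_mul' _ _ ENNReal.ofReal_ne_top
      _ ≤ ENNReal.ofReal (A * (lam * t)⁻¹ ^ 2) *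
            (ENNReal.ofReal ((K + 1) * (64 * Cb)) + ENNReal.ofReal ((K + 1) * (64 * Cb))) :=
          mul_le_mul_right hB _
      _ = ENNReal.ofReal (A * (lam * t)⁻¹ ^ 2 * (2 * ((K + 1) * (64 * Cb)))) := by
          rw [← ENNReal.ofReal_add (by positivity) (by positivity), ← two_mul,
            ← ENNReal.ofReal_mul (by positivity)]
  have hreal := ENNReal.toReal_le_of_le_ofReal (by positivity) hfin
  have hc' : c ≠ 0 := hc.ne'
  have hlam' : lam ≠ 0 := hlam0.ne'
  have ht' : t ≠ 0 := ht0.ne'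
  calc c⁻¹ * ∫ s in (0 : ℝ)..T, s * ∫ w, |f (t - s) (x + s • (w : E3))| ∂μS
      ≤ c⁻¹ * (A * (lam * t)⁻¹ ^ 2 * (2 * ((K + 1) * (64 * Cb)))) :=
        mul_le_mul_of_nonneg_left (hI.trans hreal) (inv_nonneg.2 hc.le)
    _ ≤ c⁻¹ * (A * (lam * t)⁻¹ ^ 2 * (2 * (C₃ * Real.log (1 + t) * (64 * Cb)))) := by
        gcongr
    _ = c⁻¹ * lam⁻¹ ^ 2 * (2 * (64 * Cb)) * C₃ * A * Real.log (1 + t) / t ^ 2 := by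
        field_simp

end Summit.FinalStateConjecture.FinalStateConjecture.Theorems.EIHFluxBalance.ConeRatesAreILED

end
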